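import Literature.MathematicalPhysics.QuantumFieldTheory.Balaban1983to89.B8Thm2TorusKnitOfCubeData
import Literature.MathematicalPhysics.QuantumFieldTheory.Balaban1983to89.B8Eq133Hypotheses

/-!
# `Balaban1983to89.B9Eq335CubeDatumOfReg335Zd` — [Balaban1985BackgroundPropagators] (3.35) p. 396 («for an arbitrary cube □ … there exists a gauge
# transformation u on □ such that U^u = e^{iηA}. and … |A| < O(1)Mα₀(Lʲη)⁻¹, |∇^ηA| < O(1)Mα₀(Lʲη)⁻² on □»): THE PER-CUBE (3.35) DATUM OF THE [B8] THM 2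
# TORUS ASSEMBLER (p33 FILE 16's twelve clauses for the member's reading `bgY i U₀` of a periodic `ℤ^{d+1}` background) FROM THE (3.35) DATUM OF `U₀` ITSELF
# ON A `ℤ^{d+1}` SET COVERING THE CENTRED CHART OF THE CUBE's NEIGHBOURHOOD — the carrier half of OFFER (α) (sub-row G-B8-T2S, file G4)

statement-level skeleton of published theorems with citation tags; proofs where landed; nothing here is a claim about the
Yang–Mills mass gap

T. Bałaban, *Propagators for lattice gauge theories in a background field*, Commun. Math. Phys. **99** (1985) 389–434 [Balaban1985BackgroundPropagators]
(3.35)–(3.37) p. 396, (3.28) p. 395 (the gauge action), p. 408 («a cube with a center at the center of □»); T. Bałaban, *Spaces of regular gauge field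
configurations on a lattice and gauge fixing conditions*, Commun. Math. Phys. **99** (1985) 75–102 [Balaban1985RegularSpaces] (1.33) p. 82 («U₀ satisfies the
regularity condition (3.35) in [4]»), p. 77 («we admit the case where some domains Ω_j are equal to T_η»), (1.3) p. 77 (periodicity); [Balaban1984PropagatorsII]
(2.1)–(2.4) p. 224 (the torus and its blocks).

WHY.  After G2∕G3 the torus assembler for [B8] Thm 2 displays, per member `i` and background `U₀` (a `P₀`-periodic `ℤ^{d+1}` configuration, read on the member's
torus as `bgY i U₀ = descCfg U₀`), FILE 16's per-cube (3.35) datum: for every cube `□ = c` of the member's cover, a bi-contractive gauge `u_□ : T → 𝔸ˣ`, a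
potential `A_□`, a torus set `Q_□` containing every site within coordinatewise torus distance `35S_j∕8 + 1` of the centre of `□`, sizes `C, ξ, Λ`, with
`(bgY i U₀)^{u_□} = e^{iη_iA_□}` on the bonds of `Q_□`, `|A_□| ≤ Cξ⁻¹`, `|η_i⁻¹∂A_□| ≤ Cξ⁻²` on `Q_□`, `ξ ≤ 5S_jη_i`, `L^{j+1}η_i ≤ Λξ`, and the (3.37) sizes
`max(C, C(1+D₁θ))Λ² ≤ a₁`, `≤ ¼`.  Print's (3.35) — and [B8] Prop. 6, which proves it for `U₀ ∈ 𝔄_k` (pub-ymgap `B8Prop6Reg335ZdAllTorus`, unconditional) — is a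
statement about `U₀` on a CUBE OF `ℤ^{d+1}` (r05's `Reg335Zd` ∕ r06's `Reg335Cube (shiftT) (byDir U₀)`).  THIS FILE is the carrier bridge: the datum on the torus
from the datum on any `ℤ^{d+1}` set `B` containing the coordinatewise ball of radius `35S_j∕8 + 2` about the cube's centre `ctrC □`, via the CENTRED CHART
`χ(x) = ctrC □ + rel y₀ x` (`y₀` = the centre as a torus site, `rel` = the least-absolute-value representative, `B10Eq27TorusAxialLog`): `χ` is a lift
(`transl 0 (χ x) = x`), so `U₀(χ x) = (bgY i U₀)(x)` by periodicity (`liftCfg_descCfg`); it commutes with the shifts on the ball (`rel_shift_of_le`: no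
wrap-around, since the torus has `N = M_h·L^{k+1}·P′ ≥ 2(35S_j∕8 + 3)` sites per direction whenever `j + 1 ≤ k` — displayed as `hroom`); the NearC
condition IS `|rel y₀ x| ≤ 35S_j∕8 + 1` (`circAbs` = `|valMinAbs|`).  The gauge is `u ∘ χ` inside the ball and `1` outside (bi-contractive everywhere), the
potential is `(η∕η_i)·(A ∘ χ)` (the datum of `U₀` is at spacing `η`, the member's letters at `η_i = |c_f|⁻¹`; `e^{iη_i(η∕η_i)A} = e^{iηA}` and the two bounds
rescale EXACTLY to the scale `ξ := L^{j+1}η_i` with `C := O(1)·L²`), `Λ := 1`.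

WHAT IS PROVED (kernel; 0 `def`, 0 `… : Prop` fact, 0 sorry; standard axioms; `𝔸` any complete normed `ℂ`-algebra with `‖1‖ = 1`).
* §1 chart lemmas: `transl_zero_chart` (`χ` is a lift), `abs_rel_eq_circAbs` (NearC ↔ `|rel y₀ ·| ≤ r`), `periodic_apply_chart` (`U₀ (χ x) κ = bgY i U₀ κ x`).
* §2 ★★★ `cubeDatum_of_reg335Zd` — for a member `i`, a cube `c` of its cover, a `P₀`-periodic `U₀`, `η > 0`, a constant `C_Z ≥ 0` with
  `max (C_ZL²) (C_ZL²(1 + D₁θ)) ≤ a₁` and `≤ ¼`, the room inequality `2(35S_j∕8 + 3) ≤ N`, and a set `B ⊇ {z : |z − ctrC c|_∞ ≤ 35S_j∕8 + 2}` carrying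
  `Reg335Cube (shiftT (d+1)) (byDir U₀) η B (Lʲη) C_Z` (`j` = the cube's level): FILE 16's datum `∃ u A Q C ξ Λ, …` (twelve clauses, verbatim at one cube).

HONEST SCOPE.  Carrier bookkeeping only ([folklore] lattice-gauge kinematics: charts, periodicity, gauge covariance of `e^{iηA}` under relabelling); NO estimate
of [4] ∕ [B8] is proved or used; the `ℤ^{d+1}` datum is a HYPOTHESIS here (G5 feeds it from pub-ymgap's Prop. 6 at the all-torus member); the room inequality is
displayed (it holds for every cube of level `< k`, in particular for the constant-level members of the assembler's catalogue); DESIGN constants `ξ = L^{j+1}η_i`,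
`C = C_ZL²`, `Λ = 1`, radius `+2`; count-neutral; `stub_PV3A` NOT discharged; nothing continuum ∕ ℝ⁴ ∕ OS ∕ mass-gap ∕ Clay — the Yang–Mills mass gap is NOT
proved by any of this.  No `sorry`, no `axiom`, no `def`, no `instance`, no `notation`.  NEW file; nothing landed is modified.  Cell `lit-balaban`, seat
`lit-balaban-t2s-1` gen 9, 2026-08-28; `--supports stmt-QuantumFields-19200`.
-/

noncomputable section

open scoped BigOperators

namespace Literature.MathematicalPhysics.QuantumFieldTheory.Balaban1983to89.B9Eq335CubeDatumOfReg335Zd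

open Node00 B6KLevelCensusIndexV1 B9Eq39Adjoint
open B7Prop1Explicit renaming Site → LSite
open B7Prop1Explicit (e gaugeAct)
open B4PartitionUnity22 (thetaProf D1)
open B6Cover236MultiLevelBlocks (cubes)
open B6GlobalChartV1 (PV boxEquiv boxEquiv_apply toBox_apply)
open B9BackgroundsKLevelV1 (shiftsV1 eta_pos_L_one_le_M_pos)
open B9Eq360DeltaPrimeAY (AfldY)
open B9Cor36CubeCutoffs (SC NearC one_le_SC)
open B9CubeSequence408 (ctrC)
open B4TorusKernel.MultiPeriod (circAbs)
open B9B8CarrierDictionary (liftCfg descCfg liftCfg_descCfg liftCfg_apply descCfg_apply shiftsV1_apply)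
open B8Thm2TorusLettersPerOfKnit (bgY)
open B10Eq27TorusAxialLog (rel transl rel_apply transl_apply rel_shift_of_le transl_rel)
open B8Eq133Hypotheses (shiftT byDir shiftT_apply byDir_apply gaugeTr_byDir)
open B9Eq335RegularityClasses (Reg335Cube)
open B9Cor36CutoffField337 (covD_one_apply)
open LatticeNorms (scaleLen)
open B12Ineq417Flat (shiftCfg)

variable {d ℓ : ℕ} {hd : 1 ≤ d + 1} {hL : Odd (ℓ + 1) ∧ 1 < ℓ + 1} {b₀ b₁ : ℝ}

/-! ## §1 The centred chart of a cube's neighbourhood -/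

section Chart

variable (i : KIdx d ℓ hd hL b₀ b₁) (c : ↥(cubes (toKT i).D.toDomains))

/-- **THE CENTRED CHART IS A LIFT**: `transl 0 (ctrC □ + rel y₀ x) = x`, `y₀` the centre of `□` as a torus site. [cite: Balaban1985BackgroundPropagators, p.408 («a cube with a center at the center of □»); Balaban1984PropagatorsII, (2.1) p.224 (dictionary)] -/
theorem transl_zero_chart (x : Site (PV d ℓ i.m i.K hd hL) 0) :
    transl (0 : Site (PV d ℓ i.m i.K hd hL) 0)
        (fun μ => ctrC c μ + rel (fun μ => ((ctrC c μ : ℤ) : ZMod ((PV d ℓ i.m i.K hd hL).sitesPerDir 0))) x μ) = x := by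
  funext ν
  rw [transl_apply, rel_apply]
  push_cast
  rw [add_sub_cancel, show (0 : Site (PV d ℓ i.m i.K hd hL) 0) ν = 0 from rfl, zero_add]

/-- **THE NearC CONDITION IS THE CHART's SUP-BALL**: `|rel y₀ x μ| = circAbs N (x_μ − ctrC □ μ)` (the least-absolute-value representative measures the torus
distance). [cite: Balaban1984PropagatorsII, (2.2) p.224 (torus distance), dictionary] -/
theorem abs_rel_eq_circAbs (x : Site (PV d ℓ i.m i.K hd hL) 0) (μ : Fin (d + 1)) :
    |rel (fun μ => ((ctrC c μ : ℤ) : ZMod ((PV d ℓ i.m i.K hd hL).sitesPerDir 0))) x μ| =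
      circAbs ((PV d ℓ i.m i.K hd hL).sitesPerDir 0) ((boxEquiv i.hN x).1 μ - ctrC c μ) := by
  set N := (PV d ℓ i.m i.K hd hL).sitesPerDir 0 with hN
  rw [rel_apply, boxEquiv_apply, toBox_apply, Int.abs_eq_natAbs]
  -- `|(ā − b̄)|_{ℤ/N} = circAbs N (a − b)` (as in `B5Ineq110P12Lattice`)
  have key : ∀ a b : ℤ, ((((a : ZMod N) - (b : ZMod N)).valMinAbs.natAbs : ℕ) : ℤ) = circAbs N (a - b) := by
    intro a b
    have hz : ((a : ZMod N) - (b : ZMod N)) = ((a - b : ℤ) : ZMod N) := by push_cast; rfl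
    rw [hz, ZMod.valMinAbs_natAbs_eq_min]
    have hv : ((((a - b : ℤ) : ZMod N)).val : ℤ) = (a - b) % (N : ℤ) := ZMod.val_intCast (a - b)
    have hle : (((a - b : ℤ) : ZMod N)).val ≤ N := (ZMod.val_lt _).le
    rw [Nat.cast_min, Nat.cast_sub hle, hv]
    rfl
  have hx : x μ - ((ctrC c μ : ℤ) : ZMod N) = ((((x μ).val : ℕ) : ℤ) : ZMod N) - ((ctrC c μ : ℤ) : ZMod N) := by simp
  rw [hx]
  exact key _ _

/-- **THE BACKGROUND AT THE CHART IS THE MEMBER's READING**: for a `P₀`-periodic `U₀`, `U₀ (χ x) κ = (bgY i U₀) κ x` (`χ` is a lift and `bgY = descCfg`).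
[cite: Balaban1985RegularSpaces, (1.3) p.77, p.77 («Ω_j = T_η»); Balaban1985BackgroundPropagators, (3.35) p.396] -/
theorem periodic_apply_chart {𝔸 : Type} [NormedRing 𝔸] [NormedAlgebra ℂ 𝔸] [CompleteSpace 𝔸] {U₀ : LSite (d + 1) → Fin (d + 1) → 𝔸ˣ}
    (hU₀P : ∀ (x : LSite (d + 1)) (μ : Fin (d + 1)), U₀ (x + (((PV d ℓ i.m i.K hd hL).sitesPerDir 0 : ℕ) : ℤ) • e μ) = U₀ x)
    (x : Site (PV d ℓ i.m i.K hd hL) 0) (κ : Fin (d + 1)) :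
    U₀ (fun μ => ctrC c μ + rel (fun μ => ((ctrC c μ : ℤ) : ZMod ((PV d ℓ i.m i.K hd hL).sitesPerDir 0))) x μ) κ = bgY i U₀ κ x := by
  have hsh : ∀ j : Fin (d + 1), shiftCfg ((((PV d ℓ i.m i.K hd hL).sitesPerDir 0 : ℕ) : ℤ) • e j) U₀ = U₀ := fun j => by
    funext z μ; rw [B12Ineq417Flat.shiftCfg_apply]; exact congrFun (hU₀P z j) μ
  have h := liftCfg_descCfg (P := PV d ℓ i.m i.K hd hL) hsh
  have hx := congrFun (congrFun h (fun μ => ctrC c μ + rel (fun μ => ((ctrC c μ : ℤ) : ZMod ((PV d ℓ i.m i.K hd hL).sitesPerDir 0))) x μ)) κ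
  rw [liftCfg_apply, transl_zero_chart] at hx
  rw [← hx]
  rfl

end Chart

/-! ## §2 ★★★ FILE 16's per-cube (3.35) datum from the `ℤ^{d+1}` (3.35) datum on a covering set -/

section Datum

variable {𝔸 : Type} [NormedRing 𝔸] [NormedAlgebra ℂ 𝔸] [CompleteSpace 𝔸] [NormOneClass 𝔸]

/-- ★★★ **THE PER-CUBE (3.35) DATUM OF THE TORUS ASSEMBLER FROM THE (3.35) DATUM OF `U₀` ON `ℤ^{d+1}`.**  For a member `i`, a cube `c` of its cover (level
`j`, big-block side `S_j`), a `P₀`-periodic background `U₀` on `ℤ^{d+1}`, a spacing `η > 0` for `U₀`'s datum, a constant `C_Z ≥ 0` with the (3.37) sizes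
`max (C_ZL²) (C_ZL²(1+D₁θ)) ≤ a₁`, `≤ ¼`, the room inequality `2(35S_j∕8 + 3) ≤ N` (no wrap-around), and a set `B ⊆ ℤ^{d+1}` containing the sup-ball of radius
`35S_j∕8 + 2` about `ctrC c`: IF `Reg335Cube (shiftT (d+1)) (byDir U₀) η B (Lʲη) C_Z` («a gauge u on B, bi-contractive, with U₀^u = e^{iηA} on B, |A| < C_Z(Lʲη)⁻¹,
|η⁻¹∂A| < C_Z(Lʲη)⁻²»), THEN FILE 16's datum holds at `c` for `bgY i U₀`: a bi-contractive `u_□` on the torus, `A_□`, `Q_□ ⊇ NearC_□(35S_j∕8 + 1)`, `C = C_ZL²`,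
`ξ = L^{j+1}η_i`, `Λ = 1`, with `(bgY i U₀)^{u_□} = e^{iη_iA_□}` on the bonds of `Q_□`, `|A_□| ≤ Cξ⁻¹`, `|η_i⁻¹∂A_□| ≤ Cξ⁻²` on `Q_□`, `ξ ≤ 5S_jη_i`, `L^{j+1}η_i ≤ Λξ` and
the two (3.37) sizes.  Carrier bookkeeping; nothing of [4] is proved.
[cite: Balaban1985BackgroundPropagators, (3.35)–(3.37) p.396, (3.28) p.395, p.408; Balaban1985RegularSpaces, (1.33) p.82, (1.3) p.77, p.77 («Ω_j = T_η»); Balaban1984PropagatorsII, (2.1)–(2.4) p.224] -/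
theorem cubeDatum_of_reg335Zd (i : KIdx d ℓ hd hL b₀ b₁) (c : ↥(cubes (toKT i).D.toDomains))
    {U₀ : LSite (d + 1) → Fin (d + 1) → 𝔸ˣ}
    (hU₀P : ∀ (x : LSite (d + 1)) (μ : Fin (d + 1)), U₀ (x + (((PV d ℓ i.m i.K hd hL).sitesPerDir 0 : ℕ) : ℤ) • e μ) = U₀ x)
    {η : ℝ} (hη : 0 < η) {CZ a₁ : ℝ} (hCZ : 0 ≤ CZ)
    (ha₁ : max (CZ * (((ℓ + 1 : ℕ) : ℝ)) ^ 2) (CZ * (((ℓ + 1 : ℕ) : ℝ)) ^ 2 * (1 + D1 thetaProf)) ≤ a₁)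
    (h4 : max (CZ * (((ℓ + 1 : ℕ) : ℝ)) ^ 2) (CZ * (((ℓ + 1 : ℕ) : ℝ)) ^ 2 * (1 + D1 thetaProf)) ≤ 1 / 4)
    (hroom : (35 * SC i c / 8 + 3) * 2 ≤ (((PV d ℓ i.m i.K hd hL).sitesPerDir 0 : ℕ) : ℤ))
    {B : Set (LSite (d + 1))} (hB : ∀ z : LSite (d + 1), (∀ μ, |z μ - ctrC c μ| ≤ 35 * SC i c / 8 + 2) → z ∈ B)
    (h335 : Reg335Cube (shiftT (d + 1)) (byDir U₀) η B (scaleLen (((ℓ + 1 : ℕ) : ℝ)) η c.1.1) CZ) :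
    ∃ (g : GaugeY 𝔸 i) (A : AfldY 𝔸 i) (Q : Set (Site (PV d ℓ i.m i.K hd hL) 0)) (C ξ Λ : ℝ),
      (∀ x, ‖(g x : 𝔸)‖ ≤ 1 ∧ ‖(((g x)⁻¹ : 𝔸ˣ) : 𝔸)‖ ≤ 1) ∧
      0 ≤ C ∧ 0 < ξ ∧ 1 ≤ Λ ∧ ξ ≤ 5 * (SC i c : ℝ) * (kGeo i).eta ∧
      LatticeNorms.scaleLen ((ℓ : ℝ) + 1) (kGeo i).eta (c.1.1 + 1) ≤ Λ * ξ ∧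
      (∀ x : Site (PV d ℓ i.m i.K hd hL) 0, NearC i c (35 * SC i c / 8 + 1) (boxEquiv i.hN x).1 → x ∈ Q) ∧
      (∀ (κ : Fin (d + 1)) (x : Site (PV d ℓ i.m i.K hd hL) 0), x ∈ Q → x.shift κ ∈ Q →
        gaugeY i g (bgY i U₀) κ x = fluct (kGeo i).eta A κ x) ∧
      (∀ κ, ∀ x ∈ Q, ‖A κ x‖ ≤ C * ξ⁻¹) ∧
      (∀ μ ν, ∀ x ∈ Q,
        ‖(((kGeo i).eta : ℂ)⁻¹) • covD (shiftsV1 (PV d ℓ i.m i.K hd hL)) (fun _ _ => (1 : 𝔸ˣ)) μ (A ν) x‖ ≤ C * (ξ ^ 2)⁻¹) ∧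
      max C (C * (1 + D1 thetaProf)) * Λ ^ 2 ≤ a₁ ∧ max C (C * (1 + D1 thetaProf)) * Λ ^ 2 ≤ 1 / 4 := by
  -- letters
  set P := PV d ℓ i.m i.K hd hL with hP
  set N : ℕ := P.sitesPerDir 0 with hNdef
  set r : ℤ := 35 * SC i c / 8 + 1 with hr
  set y₀ : Site P 0 := fun μ => ((ctrC c μ : ℤ) : ZMod N) with hy₀
  set χ : Site P 0 → LSite (d + 1) := fun x μ => ctrC c μ + rel y₀ x μ with hχ
  obtain ⟨hηi, hL1, -⟩ := eta_pos_L_one_le_M_pos i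
  set ηi : ℝ := (kGeo i).eta with hηi_def
  have hLdef : (kGeo i).L = ((ℓ + 1 : ℕ) : ℝ) := rfl
  set Lr : ℝ := ((ℓ + 1 : ℕ) : ℝ) with hLr
  have hLr1 : 1 ≤ Lr := by rw [hLr]; exact_mod_cast Nat.succ_le_succ (Nat.zero_le ℓ)
  have hLr0 : 0 < Lr := lt_of_lt_of_le one_pos hLr1
  -- the `ℤ^{d+1}` datum
  obtain ⟨u, A, hu, hgauge, hA, hdA⟩ := h335
  -- scales: `ξ_Z = Lʲη`, `ξ = L^{j+1}η_i`, ratio `s = η/η_i`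
  set ξZ : ℝ := scaleLen Lr η c.1.1 with hξZ
  set ξ : ℝ := scaleLen Lr ηi (c.1.1 + 1) with hξ
  have hξZ0 : 0 < ξZ := LatticeNorms.scaleLen_pos hLr0 hη _
  have hξ0 : 0 < ξ := LatticeNorms.scaleLen_pos hLr0 hηi _
  set s : ℝ := η / ηi with hs
  have hs0 : 0 < s := div_pos hη hηi
  have hsη : ηi * s = η := by rw [hs]; field_simp
  -- key scale identities: `s·ξ_Z⁻¹ = L·ξ⁻¹`… in the form used below
  have hξ_eq : ξ = Lr * (Lr ^ c.1.1 * ηi) := by rw [hξ]; unfold scaleLen; ring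
  have hξZ_eq : ξZ = Lr ^ c.1.1 * η := by rw [hξZ]; unfold scaleLen; rfl
  have hscale1 : s * ξZ⁻¹ = Lr * ξ⁻¹ := by
    rw [hξ_eq, hξZ_eq, hs]
    field_simp
  have hscale2 : ηi⁻¹ * s * (η * (ξZ ^ 2)⁻¹) = Lr ^ 2 * (ξ ^ 2)⁻¹ := by
    rw [hξ_eq, hξZ_eq, hs]
    field_simp
  -- no wrap-around on the ball of radius `r + 1`
  have hwrap : ∀ x : Site P 0, (∀ μ, |rel y₀ x μ| ≤ r + 1) → ∀ κ, rel y₀ (x.shift κ) = rel y₀ x + e κ := by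
    intro x hx κ
    refine rel_shift_of_le y₀ x κ ?_
    have h1 := (abs_le.1 (hx κ)).2
    have hN' : ((P.sitesPerDir 0 : ℕ) : ℤ) = ((N : ℕ) : ℤ) := by rw [hNdef]
    rw [hr] at h1
    rw [hN']
    omega
  have hχ_shift : ∀ x : Site P 0, (∀ μ, |rel y₀ x μ| ≤ r + 1) → ∀ κ, χ (x.shift κ) = χ x + e κ := by
    intro x hx κ
    funext μ
    simp only [hχ, hwrap x hx κ, Pi.add_apply]
    ring
  -- the chart image of the ball of radius `r + 1` lies in `B`
  have hχB : ∀ x : Site P 0, (∀ μ, |rel y₀ x μ| ≤ r + 1) → χ x ∈ B := by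
    intro x hx
    refine hB _ fun μ => ?_
    have : χ x μ - ctrC c μ = rel y₀ x μ := by simp only [hχ]; ring
    rw [this]
    exact (hx μ).trans (by rw [hr]; omega)
  -- the objects
  classical
  refine ⟨fun x => if (∀ μ, |rel y₀ x μ| ≤ r + 1) then u (χ x) else 1, fun κ x => ((s : ℝ) : ℂ) • A κ (χ x),
    {x | ∀ μ, |rel y₀ x μ| ≤ r}, CZ * Lr ^ 2, ξ, 1, ?_, by positivity, hξ0, le_rfl, ?_, ?_, ?_, ?_, ?_, ?_, ?_, ?_⟩
  · -- bi-contractivity everywhere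
    intro x
    dsimp only
    by_cases hx : ∀ μ, |rel y₀ x μ| ≤ r + 1
    · rw [if_pos hx]; exact hu _ (hχB x hx)
    · rw [if_neg hx]; simp
  · -- `ξ ≤ 5·S_j·η_i` (`L^{j+1} ≤ 5·M_h·L^{j+1}`)
    rw [hξ_eq]
    have hS : (Lr ^ (c.1.1 + 1) : ℝ) ≤ (SC i c : ℝ) := by
      have h1 : ((ℓ : ℤ) + 1) ^ (c.1.1 + 1) ≤ SC i c := by
        show ((ℓ : ℤ) + 1) ^ (c.1.1 + 1) ≤ ((B6MultiLevelBoxOperator.bigSide ℓ (toKT i).Mh c.1.1 : ℕ) : ℤ)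
        unfold B6MultiLevelBoxOperator.bigSide
        have := (toKT i).hMh
        have h2 : (ℓ + 1) ^ (c.1.1 + 1) ≤ (toKT i).Mh * (ℓ + 1) ^ (c.1.1 + 1) := Nat.le_mul_of_pos_left _ (by omega)
        exact_mod_cast h2
      have h2 : ((((ℓ : ℤ) + 1) ^ (c.1.1 + 1) : ℤ) : ℝ) ≤ ((SC i c : ℤ) : ℝ) := by exact_mod_cast h1
      rw [hLr]; push_cast at h2 ⊢; linarith
    have : Lr * (Lr ^ c.1.1 * ηi) = Lr ^ (c.1.1 + 1) * ηi := by ring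
    rw [this]
    nlinarith [hηi.le, hS]
  · -- `L^{j+1}η_i ≤ Λ·ξ`
    rw [one_mul, hξ, hLr]; push_cast; exact le_rfl
  · -- NearC ⟹ Q
    intro x hx μ
    rw [abs_rel_eq_circAbs i c x μ]
    have h := hx μ
    rwa [show (toKT i).NB μ = (PV d ℓ i.m i.K hd hL).sitesPerDir 0 from i.hN μ] at h
  · -- the gauge identity on the bonds of `Q`
    intro κ x hx hxs
    have hx' : ∀ μ, |rel y₀ x μ| ≤ r + 1 := fun μ => (hx μ).trans (by omega)
    have hxs' : ∀ μ, |rel y₀ (x.shift κ) μ| ≤ r + 1 := fun μ => (hxs μ).trans (by omega)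
    rw [gaugeY_apply, if_pos hx', if_pos hxs', hχ_shift x hx' κ, ← periodic_apply_chart i c hU₀P x κ]
    have hg := hgauge κ (χ x) (hχB x hx')
    rw [gaugeTr_byDir, byDir_apply] at hg
    show gaugeAct u U₀ (χ x) κ = _
    rw [hg]
    -- `e^{iηA(χx)} = e^{iη_i·(η/η_i)A(χx)}`
    unfold fluct
    congr 2
    rw [smul_smul]
    congr 1
    rw [← hsη]; push_cast; ring
  · -- `|A_□| ≤ C·ξ⁻¹`
    intro κ x hx
    have hx' : ∀ μ, |rel y₀ x μ| ≤ r + 1 := fun μ => (hx μ).trans (by omega)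
    have h := (hA κ (χ x) (hχB x hx')).le
    dsimp only
    rw [norm_smul, Complex.norm_real, Real.norm_of_nonneg hs0.le]
    calc s * ‖A κ (χ x)‖ ≤ s * (CZ * ξZ⁻¹) := mul_le_mul_of_nonneg_left h hs0.le
      _ = CZ * Lr * ξ⁻¹ := by rw [← mul_assoc, mul_comm s, mul_assoc, hscale1, mul_assoc]
      _ ≤ CZ * Lr ^ 2 * ξ⁻¹ := by
          have : CZ * Lr ≤ CZ * Lr ^ 2 := mul_le_mul_of_nonneg_left (by nlinarith) hCZ
          exact mul_le_mul_of_nonneg_right this (inv_nonneg.2 hξ0.le)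
  · -- `|η_i⁻¹∂A_□| ≤ C·ξ⁻²`
    intro μ ν x hx
    have hx' : ∀ μ, |rel y₀ x μ| ≤ r + 1 := fun μ => (hx μ).trans (by omega)
    have h := (hdA μ ν (χ x) (hχB x hx')).le
    rw [covD_one_apply, shiftT_apply] at h
    rw [covD_one_apply, shiftsV1_apply]
    dsimp only
    rw [hχ_shift x hx' μ, ← smul_sub, smul_smul, norm_smul]
    -- `‖η_i⁻¹·s‖·‖A(χx + e_μ) − A(χx)‖ = η_i⁻¹ s η · ‖η⁻¹(…)‖`
    have hηne : (η : ℂ) ≠ 0 := by exact_mod_cast hη.ne'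
    have hsplit : A ν (χ x + e μ) - A ν (χ x) = (η : ℂ) • (((η : ℂ)⁻¹) • (A ν (χ x + e μ) - A ν (χ x))) := by
      rw [smul_smul, mul_inv_cancel₀ hηne, one_smul]
    rw [hsplit, norm_smul, Complex.norm_real, Real.norm_of_nonneg hη.le]
    have hn : ‖((ηi : ℂ))⁻¹ * ((s : ℝ) : ℂ)‖ = ηi⁻¹ * s := by
      rw [norm_mul, norm_inv, Complex.norm_real, Complex.norm_real, Real.norm_of_nonneg hηi.le, Real.norm_of_nonneg hs0.le]
    rw [hn]
    calc ηi⁻¹ * s * (η * ‖((η : ℂ)⁻¹) • (A ν (χ x + e μ) - A ν (χ x))‖)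
        ≤ ηi⁻¹ * s * (η * (CZ * (ξZ ^ 2)⁻¹)) := by
          have h0 : 0 ≤ ηi⁻¹ * s := mul_nonneg (inv_nonneg.2 hηi.le) hs0.le
          exact mul_le_mul_of_nonneg_left (mul_le_mul_of_nonneg_left h hη.le) h0
      _ = CZ * (ηi⁻¹ * s * (η * (ξZ ^ 2)⁻¹)) := by ring
      _ = CZ * (Lr ^ 2 * (ξ ^ 2)⁻¹) := by rw [hscale2]
      _ = CZ * Lr ^ 2 * (ξ ^ 2)⁻¹ := by ring
  · rw [one_pow, mul_one, hLr]; exact ha₁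
  · rw [one_pow, mul_one, hLr]; exact h4

end Datum

end Literature.MathematicalPhysics.QuantumFieldTheory.Balaban1983to89.B9Eq335CubeDatumOfReg335Zd

end
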